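import Literature.Computability.Complexity.CanonicalCodes
import Literature.Computability.Complexity.ListFoldChecks
import Literature.Barriers.CriticalPhenomena.GridSAWCountingMembership
import Literature.Barriers.CriticalPhenomena.GridSAWCountingAnyLengthViaGridHamPath
import HarnessLib

/-!
# `SAWCOUNT₁ ∈ #P` and `SAWCOUNT₄ ∈ #P`: the verifier of self-avoiding walks and the discharge of
# the membership halves of Theorem 7 (Liśkiewicz–Ogihara–Toda 2003)

Sibling proof file of `GridSAWCountingSharpPComplete.lean` (the barrier
`GridSAWCountingSharpPComplete` = Theorem 7 (1) ∧ (4) of Liśkiewicz–Ogihara–Toda 2003) and of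
`GridSAWCountingMembership.lean`, which reduced the membership sub-facts
`LOT2003_thm7_fixedLength_mem : SAWCOUNT₁ ∈ #P` (`GridSAWCountingViaGridHamPath.lean`) and
`LOT2003_thm7_anyLength_mem : SAWCOUNT₄ ∈ #P` (`GridSAWCountingAnyLengthViaGridHamPath.lean`) to
two machine facts each — a polynomial-time VERIFIER (`SAWRel₁ ∈ P`, `SAWRel₄ ∈ P`: the witness
relation of canonically padded walk codes against canonical instance codes) and a polynomial-time
TRANSCODER (`canon₁ ∈ FP`, `canon₄ ∈ FP`: re-encoding `encode ∘ decode` of instance codes). This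
file PROVES all four (`SAWRel₁_mem_P`, `SAWRel₄_mem_P`, `canon₁_mem_FP`, `canon₄_mem_FP`) and
hence DISCHARGES the two named sub-facts: `LOT2003_thm7_fixedLength_mem_holds`,
`LOT2003_thm7_anyLength_mem_holds`. The source does not argue membership ("complete for `#P`"
is proved by the reduction); in the tree's `#P` (Arora–Barak Def. 17.2, exact witness counting)
it is the content below. No machine is written: everything is an assembly of the tree's `FP`
bricks (`BrickAlgebra`, `ListFoldBricks`/`ListFoldChecks`, `FoldBricks`, `CanonicalCodes`,
`HashBricks`, `StringEquality`, `PairingMachines`, `KannanLanguage`).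

## What is formalised (namespace `Literature.Barriers.CriticalPhenomena.GridSAW`)

* **Transcoders.** Total decoders `decPoint`, `decEdge`, `decEdgeList`, `decInstance₁`,
  `decInstance₄` (the values of the tree's decoders, which never fail) and the canonicalisers
  `canonPointFn`, `canonEdgeFn`, `canonEdgeListFn` (`CanonicalCodes.canonPairFn`/`canonListFn`
  over `canonIntFn`); `canon₁_eq_bricks`, `canon₄_eq_bricks` and **`canon₁_mem_FP`,
  `canon₄_mem_FP`**.
* **Tests on canonical codes**, each with `OneBit`, `∈ FP` and a truth lemma: `adjIntChk`
  (`|a - b| = 1` on integer codes: equal signs and magnitudes differing by one, or different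
  signs and magnitudes summing to one), `gridEdgeChk` (`IsGridEdge`), `endptChk`, `edgeEqChk`.
* **The walk verifier `sawChk`** on `⟨code E, ⟨code t, walkCode ω⟩⟩`: the conjunction of
  (1) `allFn gridEdgeChk` over `E` (`IsGridSubgraph`), (2) header non-empty (`ω ≠ []`),
  (3) `nodupFn` (`ω.Nodup`), (4) `allFn (anyFn endptChk)` (points are vertices of `E`),
  (5) `chainFn (anyFn edgeEqChk)` (`IsChain (Adj E) ω`), (6) first item = code of the origin,
  (7) last item = code of `t`; truth `sawChk_sawArg_eq_true`:
  accepted iff `IsGridSubgraph E ∧ ω ∈ sawsFromOriginTo E t`.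
* **Padded relations.** `padRel enc S` (the common shape of `SAWRel₁`, `SAWRel₄`) and
  `padRel_eq`/`padRel_mem_P`: such a relation is the intersection of six `P` languages —
  well-paired (`langA`, `rePair`), canonical instance (`langB`), exact witness length (`langC`,
  `Kannan.setOf_length_eq_mem_P`), `snd = canonical walk code ++ rest` (`langD`; the canonicaliser
  strips the padding, `canonWalk_walkCode_append`, and the rest after the walk code is the padding,
  `nthRest_walkCode_append`), `rest = 1 0 … 0` (`langE`), verifier accepts (`langV`). (`restWalkF` = the rest of the second
  component after its walk code.)
* **The verifiers** `verif₁ = sawChk ∘ argF₁ ∧ lenChk₁` (`|ω| = n + 1` by `lenBinF`/`addFn`),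
  `verif₄ = sawChk ∘ argF₄`, their truth on ALL strings (through the total decoders:
  `verif₁ z = [1] ↔ decWalk (snd z) ∈ walks₁ (decInstance₁ (fst z))`), and the assembly.

## References

* M. Liśkiewicz, M. Ogihara, S. Toda, *The complexity of counting self-avoiding walks in
  subgraphs of two-dimensional grids and hypercubes*, TCS 304 (2003) 129–156, Theorem 7.
* S. Arora, B. Barak, *Computational Complexity: A Modern Approach*, CUP 2009, Def. 17.2
  (`#P` by exact witness counting), §1.3 (closure of polynomial time), §0.1 (codes).
-/

noncomputable section

namespace Literature.Barriers.CriticalPhenomena.GridSAW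

open _root_.Computability Literature.Computability.Complexity Literature.Computability.Complexity.Brick
  Literature.Computability.Complexity.CanonCode

/-! ### Canonicalisation of grid points, edges and instances -/

/-- The grid point read off any string (total form of `encodingGridPoint.decode`). [folklore] -/
def decPoint (w : List Bool) : GridPoint := (decInt (boolUnpair w).1, decInt (boolUnpair w).2)

/-- `encodingGridPoint.decode` is total with value `decPoint`. [folklore] -/
theorem decode_point (w : List Bool) : encodingGridPoint.decode w = some (decPoint w) :=
  (canonPairFn_eq _ _ decInt decInt decode_int decode_int canonIntFn_eq canonIntFn_eq w).1

/-- Canonicalisation of grid-point codes. [folklore] -/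
noncomputable def canonPointFn : List Bool → List Bool := canonPairFn canonIntFn canonIntFn

/-- `canonPointFn = encode ∘ decPoint`. [folklore] -/
theorem canonPointFn_eq (w : List Bool) : canonPointFn w = encodingGridPoint.encode (decPoint w) :=
  (canonPairFn_eq _ _ decInt decInt decode_int decode_int canonIntFn_eq canonIntFn_eq w).2

/-- `canonPointFn ∈ FP`. [folklore] -/
theorem canonPointFn_mem_FP : canonPointFn ∈ FP := canonPairFn_mem_FP canonIntFn_mem_FP canonIntFn_mem_FP

/-- `|canonPointFn w| ≤ |w| + 17`. [folklore] -/
theorem length_canonPointFn_le (w : List Bool) : (canonPointFn w).length ≤ w.length + 17 :=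
  length_canonPairFn_le length_canonIntFn_le length_canonIntFn_le w

/-- The edge (ordered pair of grid points) read off any string. [folklore] -/
def decEdge (w : List Bool) : GridPoint × GridPoint := (decPoint (boolUnpair w).1, decPoint (boolUnpair w).2)

/-- The edge decoder is total with value `decEdge`. [folklore] -/
theorem decode_edge (w : List Bool) :
    (encodingGridPoint.pairBool encodingGridPoint).decode w = some (decEdge w) :=
  (canonPairFn_eq _ _ decPoint decPoint decode_point decode_point canonPointFn_eq canonPointFn_eq w).1

/-- Canonicalisation of edge codes. [folklore] -/
noncomputable def canonEdgeFn : List Bool → List Bool := canonPairFn canonPointFn canonPointFn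

/-- `canonEdgeFn = encode ∘ decEdge`. [folklore] -/
theorem canonEdgeFn_eq (w : List Bool) :
    canonEdgeFn w = (encodingGridPoint.pairBool encodingGridPoint).encode (decEdge w) :=
  (canonPairFn_eq _ _ decPoint decPoint decode_point decode_point canonPointFn_eq canonPointFn_eq w).2

/-- `canonEdgeFn ∈ FP`. [folklore] -/
theorem canonEdgeFn_mem_FP : canonEdgeFn ∈ FP := canonPairFn_mem_FP canonPointFn_mem_FP canonPointFn_mem_FP

/-- `|canonEdgeFn w| ≤ |w| + 53`. [folklore] -/
theorem length_canonEdgeFn_le (w : List Bool) : (canonEdgeFn w).length ≤ w.length + 53 :=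
  length_canonPairFn_le length_canonPointFn_le length_canonPointFn_le w

/-- The edge list read off any string. [folklore] -/
def decEdgeList (w : List Bool) : EdgeList := NegCNF.decList decEdge (boolUnpair w).1.length (boolUnpair w).2

/-- The edge-list decoder is total with value `decEdgeList`. [folklore] -/
theorem decode_edgeList (w : List Bool) : encodingEdgeList.decode w = some (decEdgeList w) :=
  (canonListFn_eq _ decEdge decode_edge canonEdgeFn_eq w).1

/-- Canonicalisation of edge-list codes. [folklore] -/
noncomputable def canonEdgeListFn : List Bool → List Bool := canonListFn canonEdgeFn

/-- `canonEdgeListFn = encode ∘ decEdgeList`. [folklore] -/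
theorem canonEdgeListFn_eq (w : List Bool) : canonEdgeListFn w = encodingEdgeList.encode (decEdgeList w) :=
  (canonListFn_eq _ decEdge decode_edge canonEdgeFn_eq w).2

/-- `canonEdgeListFn ∈ FP`. [folklore] -/
theorem canonEdgeListFn_mem_FP : canonEdgeListFn ∈ FP :=
  canonListFn_mem_FP canonEdgeFn_mem_FP length_canonEdgeFn_le

/-- The natural number read off any string (Mathlib's total `decodeNat`). [folklore] -/
theorem decode_nat (u : List Bool) : encodingNatBool.decode u = some (decodeNat u) := rfl

/-- The version-(1) instance read off any string. [folklore] -/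
def decInstance₁ (w : List Bool) : EdgeList × GridPoint × ℕ :=
  (decEdgeList (boolUnpair w).1, decPoint (boolUnpair (boolUnpair w).2).1,
    decodeNat (boolUnpair (boolUnpair w).2).2)

/-- The version-(1) decoder is total with value `decInstance₁`. [folklore] -/
theorem decode_instance₁ (w : List Bool) : encodingFixedLengthInstance.decode w = some (decInstance₁ w) :=
  (canonPairFn_eq _ _ decEdgeList _ decode_edgeList
    (fun u => (canonPairFn_eq _ _ decPoint decodeNat decode_point decode_nat canonPointFn_eq
      canonF_eq_encodeNat_decodeNat u).1) canonEdgeListFn_eq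
    (fun u => (canonPairFn_eq _ _ decPoint decodeNat decode_point decode_nat canonPointFn_eq
      canonF_eq_encodeNat_decodeNat u).2) w).1

/-- **`canon₁` as bricks.** [folklore] -/
theorem canon₁_eq_bricks : canon₁ = canonPairFn canonEdgeListFn (canonPairFn canonPointFn canonF) := by
  funext w
  have h := (canonPairFn_eq _ _ decEdgeList _ decode_edgeList
    (fun u => (canonPairFn_eq _ _ decPoint decodeNat decode_point decode_nat canonPointFn_eq
      canonF_eq_encodeNat_decodeNat u).1) canonEdgeListFn_eq
    (fun u => (canonPairFn_eq _ _ decPoint decodeNat decode_point decode_nat canonPointFn_eq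
      canonF_eq_encodeNat_decodeNat u).2) w)
  unfold canon₁
  rw [show encodingFixedLengthInstance = encodingEdgeList.pairBool
    (encodingGridPoint.pairBool encodingNatBool) from rfl, h.1, h.2]

/-- **Discharge: `canon₁ ∈ FP`** (the transcoder hypothesis of `LOT2003_thm7_fixedLength_mem_of`).
[cite: LiskiewiczOgiharaToda2003, Theorem 7 (version (1), membership in #P)] -/
theorem canon₁_mem_FP : canon₁ ∈ FP := by
  rw [canon₁_eq_bricks]
  exact canonPairFn_mem_FP canonEdgeListFn_mem_FP (canonPairFn_mem_FP canonPointFn_mem_FP canonF_mem_FP)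

/-- **`canon₄` as bricks.** [folklore] -/
theorem canon₄_eq_bricks : canon₄ = canonPairFn canonEdgeListFn canonPointFn := by
  funext w
  have h := canonPairFn_eq _ _ decEdgeList decPoint decode_edgeList decode_point canonEdgeListFn_eq
    canonPointFn_eq w
  unfold canon₄
  rw [show encodingAnyLengthInstance = encodingEdgeList.pairBool encodingGridPoint from rfl, h.1, h.2]

/-- **Discharge: `canon₄ ∈ FP`** (the transcoder hypothesis of `SAWCOUNT₄_mem_SharpP_of`).
[cite: LiskiewiczOgiharaToda2003, Theorem 7 (version (4), membership in #P)] -/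
theorem canon₄_mem_FP : canon₄ ∈ FP := by
  rw [canon₄_eq_bricks]
  exact canonPairFn_mem_FP canonEdgeListFn_mem_FP canonPointFn_mem_FP

end Literature.Barriers.CriticalPhenomena.GridSAW

namespace Literature.Barriers.CriticalPhenomena.GridSAW

open _root_.Computability Literature.Computability.Complexity Literature.Computability.Complexity.Brick
  Literature.Computability.Complexity.HashBricks Literature.Computability.Complexity.CanonCode
  Literature.Computability.Complexity.Classes Literature.Computability.Complexity.TTClosure
  Literature.Computability.Complexity.PRelSigma

/-! ### The codes, flat -/

/-- The code of a grid point: the pair of the codes of its coordinates. [folklore] -/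
theorem encode_point_eq (p : GridPoint) :
    encodingGridPoint.encode p = boolPair (encodingIntBool.encode p.1) (encodingIntBool.encode p.2) := rfl

/-- The code of an edge: the pair of the codes of its end points. [folklore] -/
theorem encode_edge_eq (e : GridPoint × GridPoint) :
    (encodingGridPoint.pairBool encodingGridPoint).encode e =
      boolPair (encodingGridPoint.encode e.1) (encodingGridPoint.encode e.2) := rfl

/-- The code of an edge list: unary length, then the list code of the edge codes. [folklore] -/
theorem encode_edgeList_eq (E : EdgeList) :
    encodingEdgeList.encode E = boolPair (unaryEncodeNat E.length)
      (encList (E.map (encodingGridPoint.pairBool encodingGridPoint).encode)) :=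
  listBool_encode_eq_encList _ E

/-- The code of a walk: unary length, then the list code of the point codes. [folklore] -/
theorem walkCode_eq (ω : List GridPoint) :
    walkCode ω = boolPair (unaryEncodeNat ω.length) (encList (ω.map encodingGridPoint.encode)) :=
  listBool_encode_eq_encList _ ω

/-! ### Tests on integer and point codes -/

/-- **Adjacency of integers** on a pair of integer codes `⟨a, b⟩`: `|a - b| = 1` — equal signs
and magnitudes differing by one, or different signs and magnitudes summing to one.
[cite: LiskiewiczOgiharaToda2003, §1 (the two-dimensional grid)] -/
noncomputable def adjIntChk : List Bool → List Bool :=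
  orFn (andFn (eqPairFn ∘ fanoutFn (fstF ∘ fstF) (fstF ∘ sndF))
      (orFn (eqPairFn ∘ fanoutFn (sndF ∘ fstF) (addFn ∘ fanoutFn (sndF ∘ sndF) fun _ => [true]))
        (eqPairFn ∘ fanoutFn (sndF ∘ sndF) (addFn ∘ fanoutFn (sndF ∘ fstF) fun _ => [true]))))
    (andFn (notFn (eqPairFn ∘ fanoutFn (fstF ∘ fstF) (fstF ∘ sndF)))
      (eqPairFn ∘ fanoutFn (addFn ∘ fanoutFn (sndF ∘ fstF) (sndF ∘ sndF)) fun _ => [true]))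

/-- `adjIntChk` is one-bit. [folklore] -/
theorem oneBit_adjIntChk : OneBit adjIntChk :=
  oneBit_orFn (oneBit_andFn (oneBit_eqPairFn.comp _) (oneBit_orFn (oneBit_eqPairFn.comp _)
    (oneBit_eqPairFn.comp _))) (oneBit_andFn (oneBit_notFn (oneBit_eqPairFn.comp _))
      (oneBit_eqPairFn.comp _))

/-- `adjIntChk ∈ FP`. [folklore] -/
theorem adjIntChk_mem_FP : adjIntChk ∈ FP :=
  orFn_mem_FP
    (andFn_mem_FP (comp_mem_FP eqPairFn_mem_FP (fanoutFn_mem_FP (comp_mem_FP fstF_mem_FP fstF_mem_FP)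
      (comp_mem_FP fstF_mem_FP sndF_mem_FP)))
      (orFn_mem_FP
        (comp_mem_FP eqPairFn_mem_FP (fanoutFn_mem_FP (comp_mem_FP sndF_mem_FP fstF_mem_FP)
          (comp_mem_FP addFn_mem_FP (fanoutFn_mem_FP (comp_mem_FP sndF_mem_FP sndF_mem_FP) (const_mem_FP _)))))
        (comp_mem_FP eqPairFn_mem_FP (fanoutFn_mem_FP (comp_mem_FP sndF_mem_FP sndF_mem_FP)
          (comp_mem_FP addFn_mem_FP (fanoutFn_mem_FP (comp_mem_FP sndF_mem_FP fstF_mem_FP) (const_mem_FP _)))))))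
    (andFn_mem_FP
      (notFn_mem_FP (comp_mem_FP eqPairFn_mem_FP (fanoutFn_mem_FP (comp_mem_FP fstF_mem_FP fstF_mem_FP)
        (comp_mem_FP fstF_mem_FP sndF_mem_FP))))
      (comp_mem_FP eqPairFn_mem_FP (fanoutFn_mem_FP
        (comp_mem_FP addFn_mem_FP (fanoutFn_mem_FP (comp_mem_FP sndF_mem_FP fstF_mem_FP)
          (comp_mem_FP sndF_mem_FP sndF_mem_FP))) (const_mem_FP _))))

/-- **Truth of `adjIntChk`** on a pair of integer codes. [folklore] -/
theorem adjIntChk_eq_true (a b : ℤ) :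
    adjIntChk (boolPair (encodingIntBool.encode a) (encodingIntBool.encode b)) = [true] ↔
      (a - b).natAbs = 1 := by
  have h1 : bitsToNat [true] = 1 := by simp [bitsToNat]
  have h2 : ∀ m : ℕ, encodeNat m = [true] ↔ m = 1 := fun m => by
    rw [show [true] = encodeNat 1 from rfl, encodeNat_inj]
  -- the code of an integer, flat: sign bit then canonical magnitude (as
  -- `Literature.Algebra.EuclideanLattices.GMSS.encodingIntBool_encode`, not imported here)
  have encode_int_eq : ∀ z : ℤ, encodingIntBool.encode z = boolPair [decide (z < 0)] (encodeNat z.natAbs) :=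
    fun _ => rfl
  rw [adjIntChk, orFn_eq_true_iff (oneBit_andFn (oneBit_eqPairFn.comp _) (oneBit_orFn
      (oneBit_eqPairFn.comp _) (oneBit_eqPairFn.comp _))) (oneBit_andFn (oneBit_notFn
      (oneBit_eqPairFn.comp _)) (oneBit_eqPairFn.comp _)),
    andFn_eq_true_iff (oneBit_eqPairFn.comp _) (oneBit_orFn (oneBit_eqPairFn.comp _)
      (oneBit_eqPairFn.comp _)),
    orFn_eq_true_iff (oneBit_eqPairFn.comp _) (oneBit_eqPairFn.comp _),
    andFn_eq_true_iff (oneBit_notFn (oneBit_eqPairFn.comp _)) (oneBit_eqPairFn.comp _),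
    notFn_eq_true_iff (oneBit_eqPairFn.comp _)]
  simp only [Function.comp_apply, fanoutFn_apply, encode_int_eq, fstF_boolPair, sndF_boolPair,
    addFn_boolPair, bitsToNat_encodeNat, h1, eqPairFn_boolPair_eq_true, List.cons.injEq, and_true,
    encodeNat_inj, h2, decide_eq_decide]
  omega

/-- **Grid adjacency** on an edge code `⟨p, q⟩`: `IsGridEdge p q` (equal first coordinates and
adjacent second coordinates, or conversely). [cite: LiskiewiczOgiharaToda2003, §1 (the two-dimensional grid)] -/
noncomputable def gridEdgeChk : List Bool → List Bool :=
  orFn (andFn (eqPairFn ∘ fanoutFn (fstF ∘ fstF) (fstF ∘ sndF)) (adjIntChk ∘ fanoutFn (sndF ∘ fstF) (sndF ∘ sndF)))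
    (andFn (eqPairFn ∘ fanoutFn (sndF ∘ fstF) (sndF ∘ sndF)) (adjIntChk ∘ fanoutFn (fstF ∘ fstF) (fstF ∘ sndF)))

/-- `gridEdgeChk` is one-bit. [folklore] -/
theorem oneBit_gridEdgeChk : OneBit gridEdgeChk :=
  oneBit_orFn (oneBit_andFn (oneBit_eqPairFn.comp _) (oneBit_adjIntChk.comp _))
    (oneBit_andFn (oneBit_eqPairFn.comp _) (oneBit_adjIntChk.comp _))

/-- `gridEdgeChk ∈ FP`. [folklore] -/
theorem gridEdgeChk_mem_FP : gridEdgeChk ∈ FP :=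
  orFn_mem_FP
    (andFn_mem_FP (comp_mem_FP eqPairFn_mem_FP (fanoutFn_mem_FP (comp_mem_FP fstF_mem_FP fstF_mem_FP)
      (comp_mem_FP fstF_mem_FP sndF_mem_FP)))
      (comp_mem_FP adjIntChk_mem_FP (fanoutFn_mem_FP (comp_mem_FP sndF_mem_FP fstF_mem_FP)
        (comp_mem_FP sndF_mem_FP sndF_mem_FP))))
    (andFn_mem_FP (comp_mem_FP eqPairFn_mem_FP (fanoutFn_mem_FP (comp_mem_FP sndF_mem_FP fstF_mem_FP)
      (comp_mem_FP sndF_mem_FP sndF_mem_FP)))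
      (comp_mem_FP adjIntChk_mem_FP (fanoutFn_mem_FP (comp_mem_FP fstF_mem_FP fstF_mem_FP)
        (comp_mem_FP fstF_mem_FP sndF_mem_FP))))

/-- **Truth of `gridEdgeChk`** on an edge code. [folklore] -/
theorem gridEdgeChk_eq_true (p q : GridPoint) :
    gridEdgeChk (boolPair (encodingGridPoint.encode p) (encodingGridPoint.encode q)) = [true] ↔
      IsGridEdge p q := by
  rw [gridEdgeChk, orFn_eq_true_iff (oneBit_andFn (oneBit_eqPairFn.comp _) (oneBit_adjIntChk.comp _))
      (oneBit_andFn (oneBit_eqPairFn.comp _) (oneBit_adjIntChk.comp _)),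
    andFn_eq_true_iff (oneBit_eqPairFn.comp _) (oneBit_adjIntChk.comp _),
    andFn_eq_true_iff (oneBit_eqPairFn.comp _) (oneBit_adjIntChk.comp _)]
  simp only [Function.comp_apply, fanoutFn_apply, encode_point_eq, fstF_boolPair, sndF_boolPair,
    adjIntChk_eq_true, eqPairFn_boolPair_eq_true, (encodingIntBool.encode_injective).eq_iff]
  unfold IsGridEdge
  rfl

/-- A point code `p` is one of the two end points of an edge code `e`: on `⟨p, e⟩`.
[folklore] -/
noncomputable def endptChk : List Bool → List Bool :=
  orFn (eqPairFn ∘ fanoutFn fstF (fstF ∘ sndF)) (eqPairFn ∘ fanoutFn fstF (sndF ∘ sndF))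

/-- `endptChk` is one-bit. [folklore] -/
theorem oneBit_endptChk : OneBit endptChk :=
  oneBit_orFn (oneBit_eqPairFn.comp _) (oneBit_eqPairFn.comp _)

/-- `endptChk ∈ FP`. [folklore] -/
theorem endptChk_mem_FP : endptChk ∈ FP :=
  orFn_mem_FP (comp_mem_FP eqPairFn_mem_FP (fanoutFn_mem_FP fstF_mem_FP (comp_mem_FP fstF_mem_FP sndF_mem_FP)))
    (comp_mem_FP eqPairFn_mem_FP (fanoutFn_mem_FP fstF_mem_FP (comp_mem_FP sndF_mem_FP sndF_mem_FP)))

/-- Truth of `endptChk`. [folklore] -/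
theorem endptChk_eq_true (p : GridPoint) (e : GridPoint × GridPoint) :
    endptChk (boolPair (encodingGridPoint.encode p)
      ((encodingGridPoint.pairBool encodingGridPoint).encode e)) = [true] ↔ p = e.1 ∨ p = e.2 := by
  rw [endptChk, orFn_eq_true_iff (oneBit_eqPairFn.comp _) (oneBit_eqPairFn.comp _)]
  simp only [Function.comp_apply, fanoutFn_apply, encode_edge_eq, fstF_boolPair, sndF_boolPair,
    eqPairFn_boolPair_eq_true, (encodingGridPoint.encode_injective).eq_iff]

/-- An ordered pair of point codes `⟨p, q⟩` is the edge code `e` in one of the two orientations: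
on `⟨⟨p, q⟩, e⟩`. [folklore] -/
noncomputable def edgeEqChk : List Bool → List Bool :=
  orFn (eqPairFn ∘ fanoutFn fstF sndF)
    (eqPairFn ∘ fanoutFn (fanoutFn (sndF ∘ fstF) (fstF ∘ fstF)) sndF)

/-- `edgeEqChk` is one-bit. [folklore] -/
theorem oneBit_edgeEqChk : OneBit edgeEqChk :=
  oneBit_orFn (oneBit_eqPairFn.comp _) (oneBit_eqPairFn.comp _)

/-- `edgeEqChk ∈ FP`. [folklore] -/
theorem edgeEqChk_mem_FP : edgeEqChk ∈ FP :=
  orFn_mem_FP (comp_mem_FP eqPairFn_mem_FP (fanoutFn_mem_FP fstF_mem_FP sndF_mem_FP))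
    (comp_mem_FP eqPairFn_mem_FP (fanoutFn_mem_FP (fanoutFn_mem_FP (comp_mem_FP sndF_mem_FP fstF_mem_FP)
      (comp_mem_FP fstF_mem_FP fstF_mem_FP)) sndF_mem_FP))

/-- Truth of `edgeEqChk`. [folklore] -/
theorem edgeEqChk_eq_true (p q : GridPoint) (e : GridPoint × GridPoint) :
    edgeEqChk (boolPair (boolPair (encodingGridPoint.encode p) (encodingGridPoint.encode q))
      ((encodingGridPoint.pairBool encodingGridPoint).encode e)) = [true] ↔ (p, q) = e ∨ (q, p) = e := by
  have hinj := (encodingGridPoint.pairBool encodingGridPoint).encode_injective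
  have hpq : ∀ p q : GridPoint, boolPair (encodingGridPoint.encode p) (encodingGridPoint.encode q) =
      (encodingGridPoint.pairBool encodingGridPoint).encode (p, q) := fun _ _ => rfl
  rw [edgeEqChk, orFn_eq_true_iff (oneBit_eqPairFn.comp _) (oneBit_eqPairFn.comp _)]
  simp only [Function.comp_apply, fanoutFn_apply, fstF_boolPair, sndF_boolPair, eqPairFn_boolPair_eq_true]
  rw [hpq, hpq, hinj.eq_iff, hinj.eq_iff]

/-! ### The verifier of walks on canonical codes -/

/-- Dropping `j` items of a list code, also in front of a suffix. [folklore] -/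
theorem sndF_iterate_encList_append (t : List Bool) :
    ∀ (j : ℕ) (l : List (List Bool)), j ≤ l.length →
      sndF^[j] (encList l ++ t) = encList (l.drop j) ++ t
  | 0, _, _ => rfl
  | j + 1, [], h => by simp at h
  | j + 1, a :: l, h => by
    rw [Function.iterate_succ_apply, encList_cons, show boolPair a (encList l) ++ t =
      boolPair a (encList l ++ t) by simp [boolPair, List.append_assoc], sndF_boolPair,
      sndF_iterate_encList_append t j l (by simpa using h), List.drop_succ_cons]

/-- Dropping `j` items of a list code. [folklore] -/
theorem sndF_iterate_encList (j : ℕ) (l : List (List Bool)) (h : j ≤ l.length) :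
    sndF^[j] (encList l) = encList (l.drop j) := by
  simpa using sndF_iterate_encList_append [] j l h

/-- The code of the origin. [folklore] -/
def originCode : List Bool := encodingGridPoint.encode gridOrigin

/-- **The walk verifier on canonical codes** `s = ⟨code E, ⟨code t, walkCode ω⟩⟩`: the
conjunction of (1) every listed edge is a grid edge, (2) `ω ≠ []`, (3) `ω` has no repeated
point, (4) every point of `ω` is an end point of a listed edge, (5) consecutive points of `ω`
are joined by a listed edge, (6) `ω` starts at the origin, (7) `ω` ends at `t`.
[cite: LiskiewiczOgiharaToda2003, Theorem 7 (membership in #P: "a path … that does not visit any node more than once")] -/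
noncomputable def sawChk : List Bool → List Bool :=
  andFn (allFn (gridEdgeChk ∘ sndF) ∘ fanoutFn (fun _ => []) (sndF ∘ fstF))
  (andFn (notFn (isNilFn ∘ fstF ∘ sndPow 1))
  (andFn (nodupFn ∘ fanoutFn (fun _ => []) (sndF ∘ sndPow 1))
  (andFn (allFn (anyFn endptChk ∘ fanoutFn sndF fstF) ∘ fanoutFn (sndF ∘ fstF) (sndF ∘ sndPow 1))
  (andFn (chainFn (anyFn edgeEqChk ∘ fanoutFn sndF fstF) ∘ fanoutFn (sndF ∘ fstF) (sndF ∘ sndPow 1))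
  (andFn (eqPairFn ∘ fanoutFn (fun _ => originCode) (fstF ∘ sndF ∘ sndPow 1))
    (eqPairFn ∘ fanoutFn (nthF 1) (nthItemFn ∘ fanoutFn (List.tail ∘ fstF ∘ sndPow 1) (sndF ∘ sndPow 1))))))))

/-- The seven conjuncts are one-bit. [folklore] -/
theorem oneBit_sawChk_parts :
    OneBit (allFn (gridEdgeChk ∘ sndF) ∘ fanoutFn (fun _ => []) (sndF ∘ fstF)) ∧
    OneBit (notFn (isNilFn ∘ fstF ∘ sndPow 1)) ∧
    OneBit (nodupFn ∘ fanoutFn (fun _ => []) (sndF ∘ sndPow 1)) ∧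
    OneBit (allFn (anyFn endptChk ∘ fanoutFn sndF fstF) ∘ fanoutFn (sndF ∘ fstF) (sndF ∘ sndPow 1)) ∧
    OneBit (chainFn (anyFn edgeEqChk ∘ fanoutFn sndF fstF) ∘ fanoutFn (sndF ∘ fstF) (sndF ∘ sndPow 1)) ∧
    OneBit (eqPairFn ∘ fanoutFn (fun _ => originCode) (fstF ∘ sndF ∘ sndPow 1)) ∧
    OneBit (eqPairFn ∘ fanoutFn (nthF 1)
      (nthItemFn ∘ fanoutFn (List.tail ∘ fstF ∘ sndPow 1) (sndF ∘ sndPow 1))) :=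
  ⟨(oneBit_allFn (oneBit_gridEdgeChk.comp _)).comp _, oneBit_notFn (oneBit_isNilFn.comp _),
    oneBit_nodupFn.comp _, (oneBit_allFn ((oneBit_anyFn oneBit_endptChk).comp _)).comp _,
    (oneBit_chainFn _).comp _, oneBit_eqPairFn.comp _, oneBit_eqPairFn.comp _⟩

/-- `sawChk` is one-bit. [folklore] -/
theorem oneBit_sawChk : OneBit sawChk := by
  obtain ⟨h1, h2, h3, h4, h5, h6, h7⟩ := oneBit_sawChk_parts
  exact oneBit_andFn h1 (oneBit_andFn h2 (oneBit_andFn h3 (oneBit_andFn h4 (oneBit_andFn h5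
    (oneBit_andFn h6 h7)))))

/-- `sawChk ∈ FP`. [folklore] -/
theorem sawChk_mem_FP : sawChk ∈ FP :=
  andFn_mem_FP (comp_mem_FP (allFn_mem_FP (comp_mem_FP gridEdgeChk_mem_FP sndF_mem_FP)
      (oneBit_gridEdgeChk.comp _)) (fanoutFn_mem_FP (const_mem_FP _) (comp_mem_FP sndF_mem_FP fstF_mem_FP)))
  (andFn_mem_FP (notFn_mem_FP (comp_mem_FP isNilFn_mem_FP (comp_mem_FP fstF_mem_FP (sndPow_mem_FP 1))))
  (andFn_mem_FP (comp_mem_FP nodupFn_mem_FP (fanoutFn_mem_FP (const_mem_FP _)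
      (comp_mem_FP sndF_mem_FP (sndPow_mem_FP 1))))
  (andFn_mem_FP (comp_mem_FP (allFn_mem_FP (comp_mem_FP (anyFn_mem_FP endptChk_mem_FP oneBit_endptChk)
      (fanoutFn_mem_FP sndF_mem_FP fstF_mem_FP)) ((oneBit_anyFn oneBit_endptChk).comp _))
      (fanoutFn_mem_FP (comp_mem_FP sndF_mem_FP fstF_mem_FP) (comp_mem_FP sndF_mem_FP (sndPow_mem_FP 1))))
  (andFn_mem_FP (comp_mem_FP (chainFn_mem_FP (comp_mem_FP (anyFn_mem_FP edgeEqChk_mem_FP oneBit_edgeEqChk)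
      (fanoutFn_mem_FP sndF_mem_FP fstF_mem_FP)) ((oneBit_anyFn oneBit_edgeEqChk).comp _))
      (fanoutFn_mem_FP (comp_mem_FP sndF_mem_FP fstF_mem_FP) (comp_mem_FP sndF_mem_FP (sndPow_mem_FP 1))))
  (andFn_mem_FP (comp_mem_FP eqPairFn_mem_FP (fanoutFn_mem_FP (const_mem_FP _)
      (comp_mem_FP fstF_mem_FP (comp_mem_FP sndF_mem_FP (sndPow_mem_FP 1)))))
    (comp_mem_FP eqPairFn_mem_FP (fanoutFn_mem_FP (nthF_mem_FP 1) (comp_mem_FP nthItemFn_mem_FP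
      (fanoutFn_mem_FP (comp_mem_FP PRelSigma.tail_mem_FP (comp_mem_FP fstF_mem_FP (sndPow_mem_FP 1)))
        (comp_mem_FP sndF_mem_FP (sndPow_mem_FP 1)))))))))))

section Truth

variable (E : EdgeList) (t : GridPoint) (ω : List GridPoint)

/-- The canonical argument of the verifier. [folklore] -/
noncomputable def sawArg : List Bool :=
  boolPair (encodingEdgeList.encode E) (boolPair (encodingGridPoint.encode t) (walkCode ω))

/-- (1) is `IsGridSubgraph`. [folklore] -/
theorem sawChk_part1 :
    (allFn (gridEdgeChk ∘ sndF) ∘ fanoutFn (fun _ => []) (sndF ∘ fstF)) (sawArg E t ω) = [true] ↔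
      IsGridSubgraph E := by
  simp only [sawArg, Function.comp_apply, fanoutFn_apply, fstF_boolPair, sndF_boolPair, encode_edgeList_eq,
    allFn_boolPair_eq_true (oneBit_gridEdgeChk.comp _), decNil_encList, List.forall_mem_map, IsGridSubgraph]
  refine forall₂_congr fun e _ => ?_
  rw [encode_edge_eq, gridEdgeChk_eq_true]

/-- (2) is `ω ≠ []`. [folklore] -/
theorem sawChk_part2 : (notFn (isNilFn ∘ fstF ∘ sndPow 1)) (sawArg E t ω) = [true] ↔ ω ≠ [] := by
  rw [notFn_eq_true_iff (oneBit_isNilFn.comp _)]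
  simp only [sawArg, Function.comp_apply, sndPow, fstF_boolPair, sndF_boolPair, walkCode_eq,
    isNilFn_eq_true_iff]
  cases ω <;> simp [unaryEncodeNat]

/-- (3) is `ω.Nodup`. [folklore] -/
theorem sawChk_part3 :
    (nodupFn ∘ fanoutFn (fun _ => []) (sndF ∘ sndPow 1)) (sawArg E t ω) = [true] ↔ ω.Nodup := by
  simp only [sawArg, Function.comp_apply, fanoutFn_apply, sndPow, sndF_boolPair, walkCode_eq,
    nodupFn_encList_eq_true]
  exact List.nodup_map_iff encodingGridPoint.encode_injective

/-- (4) is "every point is a vertex of `E`". [folklore] -/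
theorem sawChk_part4 :
    (allFn (anyFn endptChk ∘ fanoutFn sndF fstF) ∘ fanoutFn (sndF ∘ fstF) (sndF ∘ sndPow 1)) (sawArg E t ω) =
      [true] ↔ ∀ p ∈ ω, p ∈ vertexSet E := by
  simp only [sawArg, Function.comp_apply, fanoutFn_apply, sndPow, fstF_boolPair, sndF_boolPair,
    encode_edgeList_eq, walkCode_eq, allFn_boolPair_eq_true ((oneBit_anyFn oneBit_endptChk).comp _),
    decNil_encList, List.forall_mem_map, anyFn_boolPair_eq_true oneBit_endptChk]
  refine forall₂_congr fun p _ => ?_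
  have key : (∃ a ∈ E.map (encodingGridPoint.pairBool encodingGridPoint).encode,
      endptChk (boolPair (encodingGridPoint.encode p) a) = [true]) ↔ ∃ e ∈ E, p = e.1 ∨ p = e.2 :=
    ⟨fun ⟨a, ha, h⟩ => by
      obtain ⟨e, he, rfl⟩ := List.mem_map.1 ha
      exact ⟨e, he, (endptChk_eq_true p e).1 h⟩,
     fun ⟨e, he, h⟩ => ⟨_, List.mem_map.2 ⟨e, he, rfl⟩, (endptChk_eq_true p e).2 h⟩⟩
  rw [key]
  simp only [vertexSet, List.mem_toFinset, List.mem_append, List.mem_map]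
  constructor
  · rintro ⟨e, he, rfl | rfl⟩
    · exact Or.inl ⟨e, he, rfl⟩
    · exact Or.inr ⟨e, he, rfl⟩
  · rintro (⟨e, he, rfl⟩ | ⟨e, he, rfl⟩)
    · exact ⟨e, he, Or.inl rfl⟩
    · exact ⟨e, he, Or.inr rfl⟩

/-- (5) is `IsChain (Adj E) ω`. [folklore] -/
theorem sawChk_part5 :
    (chainFn (anyFn edgeEqChk ∘ fanoutFn sndF fstF) ∘ fanoutFn (sndF ∘ fstF) (sndF ∘ sndPow 1))
      (sawArg E t ω) = [true] ↔ List.IsChain (Adj E) ω := by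
  simp only [sawArg, Function.comp_apply, fanoutFn_apply, sndPow, fstF_boolPair, sndF_boolPair,
    encode_edgeList_eq, walkCode_eq, chainFn_encList_eq_true ((oneBit_anyFn oneBit_edgeEqChk).comp _),
    List.isChain_map]
  refine List.IsChain.iff fun p q => ?_
  simp only [anyFn_boolPair_eq_true oneBit_edgeEqChk, decNil_encList]
  have key : (∃ a ∈ E.map (encodingGridPoint.pairBool encodingGridPoint).encode,
      edgeEqChk (boolPair (boolPair (encodingGridPoint.encode p) (encodingGridPoint.encode q)) a) = [true]) ↔
      ∃ e ∈ E, (p, q) = e ∨ (q, p) = e :=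
    ⟨fun ⟨a, ha, h⟩ => by
      obtain ⟨e, he, rfl⟩ := List.mem_map.1 ha
      exact ⟨e, he, (edgeEqChk_eq_true p q e).1 h⟩,
     fun ⟨e, he, h⟩ => ⟨_, List.mem_map.2 ⟨e, he, rfl⟩, (edgeEqChk_eq_true p q e).2 h⟩⟩
  rw [key, Adj]
  constructor
  · rintro ⟨e, he, h | h⟩
    · exact Or.inl (h ▸ he)
    · exact Or.inr (h ▸ he)
  · rintro (h | h)
    · exact ⟨_, h, Or.inl rfl⟩
    · exact ⟨_, h, Or.inr rfl⟩

/-- (6) is "`ω` starts at the origin". [folklore] -/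
theorem sawChk_part6 :
    (eqPairFn ∘ fanoutFn (fun _ => originCode) (fstF ∘ sndF ∘ sndPow 1)) (sawArg E t ω) = [true] ↔
      ω.head? = some gridOrigin := by
  simp only [sawArg, Function.comp_apply, fanoutFn_apply, sndPow, sndF_boolPair, walkCode_eq,
    eqPairFn_boolPair_eq_true, originCode]
  cases ω with
  | nil =>
    simp only [List.map_nil, encList_nil, List.head?_nil, reduceCtorEq, iff_false]
    simp [fstF, boolUnpair, encode_point_eq, boolPair]
  | cons p ω =>
    simp only [List.map_cons, encList_cons, fstF_boolPair, List.head?_cons, Option.some.injEq]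
    rw [eq_comm, (encodingGridPoint.encode_injective).eq_iff]

/-- (7) is "`ω` ends at `t`". [folklore] -/
theorem sawChk_part7 :
    (eqPairFn ∘ fanoutFn (nthF 1) (nthItemFn ∘ fanoutFn (List.tail ∘ fstF ∘ sndPow 1) (sndF ∘ sndPow 1)))
      (sawArg E t ω) = [true] ↔ ω.getLast? = some t := by
  simp only [sawArg, Function.comp_apply, fanoutFn_apply, sndPow, nthF, fstF_boolPair, sndF_boolPair,
    walkCode_eq, eqPairFn_boolPair_eq_true, nthItemFn_boolPair, List.length_tail,
    OracleCompose.unaryEncodeNat_eq_replicate, List.length_replicate]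
  rw [sndF_iterate_encList _ _ (by simp)]
  cases ω.eq_nil_or_concat with
  | inl h =>
    subst h
    simp only [List.map_nil, List.length_nil, List.drop_nil, encList_nil, List.getLast?_nil, reduceCtorEq,
      iff_false]
    simp [fstF, boolUnpair, encode_point_eq, boolPair]
  | inr h =>
    obtain ⟨ω', p, rfl⟩ := h
    rw [List.concat_eq_append, List.map_append, List.length_append, List.length_singleton, Nat.add_sub_cancel,
      List.drop_append_of_le_length (by simp), List.drop_eq_nil_of_le (by simp), List.nil_append,
      List.map_singleton, encList_cons, fstF_boolPair, List.getLast?_append, List.getLast?_singleton]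
    simp only [Option.some_or, Option.some.injEq]
    rw [(encodingGridPoint.encode_injective).eq_iff, eq_comm]

/-- **Truth of the walk verifier**: on `⟨code E, ⟨code t, walkCode ω⟩⟩` it accepts iff `E` is a
subgraph of the grid and `ω` is a self-avoiding walk of `E` from the origin to `t`.
[cite: LiskiewiczOgiharaToda2003, Theorem 7 (membership in #P)] -/
theorem sawChk_sawArg_eq_true :
    sawChk (sawArg E t ω) = [true] ↔ IsGridSubgraph E ∧ ω ∈ sawsFromOriginTo E t := by
  obtain ⟨h1, h2, h3, h4, h5, h6, h7⟩ := oneBit_sawChk_parts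
  rw [sawChk, andFn_eq_true_iff h1 (oneBit_andFn h2 (oneBit_andFn h3 (oneBit_andFn h4 (oneBit_andFn h5
      (oneBit_andFn h6 h7))))), andFn_eq_true_iff h2 (oneBit_andFn h3 (oneBit_andFn h4 (oneBit_andFn h5
      (oneBit_andFn h6 h7)))), andFn_eq_true_iff h3 (oneBit_andFn h4 (oneBit_andFn h5 (oneBit_andFn h6 h7))),
    andFn_eq_true_iff h4 (oneBit_andFn h5 (oneBit_andFn h6 h7)), andFn_eq_true_iff h5 (oneBit_andFn h6 h7),
    andFn_eq_true_iff h6 h7, sawChk_part1, sawChk_part2, sawChk_part3, sawChk_part4, sawChk_part5,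
    sawChk_part6, sawChk_part7]
  simp only [sawsFromOriginTo, Set.mem_setOf_eq, IsSAWIn]
  tauto

end Truth

/-! ### Reading walks off arbitrary strings -/

/-- The walk read off any string (total form of the decoder of walk codes). [folklore] -/
def decWalk (y : List Bool) : List GridPoint :=
  NegCNF.decList decPoint (boolUnpair y).1.length (boolUnpair y).2

/-- The walk-code canonicaliser `canonListFn canonPointFn` re-encodes the decoded walk. [folklore] -/
theorem canonWalk_eq (y : List Bool) : canonListFn canonPointFn y = walkCode (decWalk y) :=
  (canonListFn_eq _ decPoint decode_point canonPointFn_eq y).2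

/-- `decPoint` inverts the point code. [folklore] -/
theorem decPoint_encode (p : GridPoint) : decPoint (encodingGridPoint.encode p) = p := by
  have h := decode_point (encodingGridPoint.encode p)
  rw [encodingGridPoint.decode_encode] at h
  exact (Option.some.inj h).symm

/-- `canonPointFn` fixes point codes. [folklore] -/
theorem canonPointFn_encode (p : GridPoint) : canonPointFn (encodingGridPoint.encode p) = encodingGridPoint.encode p := by
  rw [canonPointFn_eq, decPoint_encode]

/-- Reading `|l|` items off a list code followed by anything, with an item map that is the
identity on the items, returns the items. [folklore] -/
theorem itemsCanon_encList_append {ci : List Bool → List Bool} (t : List Bool) :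
    ∀ l : List (List Bool), (∀ a ∈ l, ci a = a) → itemsCanon ci l.length (encList l ++ t) = encList l
  | [], _ => rfl
  | a :: l, h => by
    rw [List.length_cons, itemsCanon, encList_cons, show boolPair a (encList l) ++ t =
      boolPair a (encList l ++ t) by simp [boolPair, List.append_assoc], boolUnpair_boolPair]
    dsimp only
    rw [itemsCanon_encList_append t l fun b hb => h b (List.mem_cons_of_mem a hb), h a List.mem_cons_self,
      CookLevin.boolPair_eq_dbl]

/-- Decoding `|l|` items off a list code followed by anything. [folklore] -/
theorem decList_encList_append {α : Type} (d : List Bool → α) (t : List Bool) :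
    ∀ l : List (List Bool), NegCNF.decList d l.length (encList l ++ t) = l.map d
  | [] => rfl
  | a :: l => by
    rw [List.length_cons, NegCNF.decList, encList_cons, show boolPair a (encList l) ++ t =
      boolPair a (encList l ++ t) by simp [boolPair, List.append_assoc], boolUnpair_boolPair]
    dsimp only
    rw [decList_encList_append d t l, List.map_cons]

/-- A walk code followed by anything is a pair code with the same header. [folklore] -/
theorem walkCode_append (ω : List GridPoint) (t : List Bool) :
    walkCode ω ++ t = boolPair (unaryEncodeNat ω.length) (encList (ω.map encodingGridPoint.encode) ++ t) := by
  rw [walkCode_eq]; simp [boolPair, List.append_assoc]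

/-- **The canonicaliser strips the padding**: on a walk code followed by anything it returns
the walk code. [folklore] -/
theorem canonWalk_walkCode_append (ω : List GridPoint) (t : List Bool) :
    canonListFn canonPointFn (walkCode ω ++ t) = walkCode ω := by
  rw [walkCode_append, canonListFn_apply, boolUnpair_boolPair]
  dsimp only
  have h := itemsCanon_encList_append (ci := canonPointFn) t (ω.map encodingGridPoint.encode)
    (fun a ha => by obtain ⟨p, -, rfl⟩ := List.mem_map.1 ha; exact canonPointFn_encode p)
  rw [List.length_map] at h
  rw [Literature.Computability.MetaComplexity.length_unaryEncodeNat, h, walkCode_eq]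

/-- **The decoder strips the padding**: a walk code followed by anything decodes to the walk.
[folklore] -/
theorem decWalk_walkCode_append (ω : List GridPoint) (t : List Bool) : decWalk (walkCode ω ++ t) = ω := by
  rw [decWalk, walkCode_append, boolUnpair_boolPair]
  dsimp only
  have h := decList_encList_append decPoint t (ω.map encodingGridPoint.encode)
  rw [List.length_map] at h
  rw [Literature.Computability.MetaComplexity.length_unaryEncodeNat, h, List.map_map]
  simp [Function.comp_def, decPoint_encode]

/-- The rest after the items of the second component, `snd^{|fst y|} (snd y)`. [folklore] -/
theorem nthRest_eq (y : List Bool) : PRelSigPi.nthRest y = sndF^[(boolUnpair y).1.length] (boolUnpair y).2 := rfl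

/-- **The rest after a walk code is the padding.** [folklore] -/
theorem nthRest_walkCode_append (ω : List GridPoint) (t : List Bool) : PRelSigPi.nthRest (walkCode ω ++ t) = t := by
  rw [nthRest_eq, walkCode_append, boolUnpair_boolPair]
  dsimp only
  rw [Literature.Computability.MetaComplexity.length_unaryEncodeNat, sndF_iterate_encList_append t _ _ (by simp), List.drop_eq_nil_of_le (by simp)]
  rfl

/-! ### Witness relations of padded walk codes are in `P` -/

/-- Well-paired strings: `z = ⟨fst z, snd z⟩`. [folklore] -/
def langA : Language Bool := {z | rePair z = z}

/-- Membership in `langA`. [folklore] -/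
theorem mem_langA (z : List Bool) : z ∈ langA ↔ rePair z = z := Iff.rfl

/-- `langA ∈ P`. [folklore] -/
theorem langA_mem_P : langA ∈ P := by
  have h : langA = fanoutFn rePair id ⁻¹' EqPair := Set.ext fun z => by
    change rePair z = z ↔ fanoutFn rePair id z ∈ EqPair
    rw [fanoutFn_apply, boolPair_mem_EqPair]; exact Iff.rfl
  rw [h]; exact preimage_mem_P EqPair_mem_P (fanoutFn_mem_FP rePair_mem_FP (PolyTimeComputable.id _))

/-- Strings whose first component is fixed by `can`. [folklore] -/
def langB (can : List Bool → List Bool) : Language Bool := {z | can (fstF z) = fstF z}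

/-- Membership in `langB`. [folklore] -/
theorem mem_langB (can : List Bool → List Bool) (z : List Bool) : z ∈ langB can ↔ can (fstF z) = fstF z := Iff.rfl

/-- `langB can ∈ P` for `can ∈ FP`. [folklore] -/
theorem langB_mem_P {can : List Bool → List Bool} (h : can ∈ FP) : langB can ∈ P := by
  have he : langB can = fanoutFn (can ∘ fstF) fstF ⁻¹' EqPair := Set.ext fun z => by
    change can (fstF z) = fstF z ↔ fanoutFn (can ∘ fstF) fstF z ∈ EqPair
    rw [fanoutFn_apply, boolPair_mem_EqPair]; exact Iff.rfl
  rw [he]; exact preimage_mem_P EqPair_mem_P (fanoutFn_mem_FP (comp_mem_FP h fstF_mem_FP) fstF_mem_FP)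

/-- Strings whose second component has the exact witness length. [folklore] -/
def langC : Language Bool := {z | (sndF z).length = witnessPoly.eval (fstF z).length}

/-- Membership in `langC`. [folklore] -/
theorem mem_langC (z : List Bool) : z ∈ langC ↔ (sndF z).length = witnessPoly.eval (fstF z).length := Iff.rfl

/-- `langC ∈ P`. [folklore] -/
theorem langC_mem_P : langC ∈ P := Kannan.setOf_length_eq_mem_P fstF_mem_FP sndF_mem_FP witnessPoly

/-- The canonical walk code read off the second component. [folklore] -/
noncomputable def canonWalkF : List Bool → List Bool := canonListFn canonPointFn ∘ sndF

/-- `canonWalkF ∈ FP`. [folklore] -/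
theorem canonWalkF_mem_FP : canonWalkF ∈ FP :=
  comp_mem_FP (canonListFn_mem_FP canonPointFn_mem_FP length_canonPointFn_le) sndF_mem_FP

/-- The rest of the second component after its walk code. [folklore] -/
noncomputable def restWalkF : List Bool → List Bool := PRelSigPi.nthRest ∘ sndF

/-- `restWalkF ∈ FP`. [folklore] -/
theorem restWalkF_mem_FP : restWalkF ∈ FP := comp_mem_FP PRelSigPi.nthRest_mem_FP sndF_mem_FP

/-- Strings whose second component is a canonical walk code followed by its rest. [folklore] -/
def langD : Language Bool := {z | sndF z = canonWalkF z ++ restWalkF z}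

/-- Membership in `langD`. [folklore] -/
theorem mem_langD (z : List Bool) : z ∈ langD ↔ sndF z = canonWalkF z ++ restWalkF z := Iff.rfl

/-- `langD ∈ P`. [folklore] -/
theorem langD_mem_P : langD ∈ P := by
  have he : langD = fanoutFn sndF (appF ∘ fanoutFn canonWalkF restWalkF) ⁻¹' EqPair := Set.ext fun z => by
    change sndF z = canonWalkF z ++ restWalkF z ↔ fanoutFn sndF (appF ∘ fanoutFn canonWalkF restWalkF) z ∈ EqPair
    rw [fanoutFn_apply, boolPair_mem_EqPair, Function.comp_apply, fanoutFn_apply, appF, fstF_boolPair,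
      sndF_boolPair]
  rw [he]
  exact preimage_mem_P EqPair_mem_P
    (fanoutFn_mem_FP sndF_mem_FP (comp_mem_FP appF_mem_FP (fanoutFn_mem_FP canonWalkF_mem_FP restWalkF_mem_FP)))

/-- Strings whose rest is a padding `1 0 … 0`. [folklore] -/
def langE : Language Bool := {z | (restWalkF z).head? = some true ∧ true ∉ (restWalkF z).tail}

/-- Membership in `langE`. [folklore] -/
theorem mem_langE (z : List Bool) : z ∈ langE ↔ (restWalkF z).head? = some true ∧ true ∉ (restWalkF z).tail := Iff.rfl

/-- `langE ∈ P`. [folklore] -/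
theorem langE_mem_P : langE ∈ P := by
  have he : langE = (restWalkF ⁻¹' HeadIs true) ⊓ ((List.tail ∘ restWalkF) ⁻¹' (HasBit true)ᶜ) := Set.ext fun z => by
    change (restWalkF z).head? = some true ∧ true ∉ (restWalkF z).tail ↔
      restWalkF z ∈ HeadIs true ∧ (List.tail ∘ restWalkF) z ∈ (HasBit true)ᶜ
    exact Iff.rfl
  rw [he]
  exact inter_mem_P (preimage_mem_P (HeadIs_mem_P true) restWalkF_mem_FP)
    (preimage_mem_P (compl_mem_P_iff.2 (HasBit_mem_P true)) (comp_mem_FP tail_mem_FP restWalkF_mem_FP))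

/-- Strings accepted by a one-bit verifier. [folklore] -/
def langV (V : List Bool → List Bool) : Language Bool := {z | V z = [true]}

/-- Membership in `langV`. [folklore] -/
theorem mem_langV (V : List Bool → List Bool) (z : List Bool) : z ∈ langV V ↔ V z = [true] := Iff.rfl

/-- `langV V ∈ P` for a one-bit `V ∈ FP`. [folklore] -/
theorem langV_mem_P {V : List Bool → List Bool} (h1 : OneBit V) (hFP : V ∈ FP) : langV V ∈ P :=
  mem_P_of_mem_FP hFP _ fun z => by
    obtain ⟨b, hb⟩ := h1 z
    refine ⟨fun h => h, fun h => ?_⟩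
    change ¬ V z = [true] at h
    rw [hb] at h ⊢
    cases b
    · rfl
    · exact absurd rfl h

section Relation

variable {ι : Type} (enc : ι → List Bool) (S : ι → Set (List GridPoint))

/-- The common shape of `SAWRel₁` and `SAWRel₄`: pairs `⟨enc i, padTo (witnessPoly |enc i|) (walkCode ω)⟩`
with `ω ∈ S i`. [cite: AroraBarak2009, Def. 17.2] -/
def padRel : Language Bool :=
  {z | ∃ i, ∃ ω ∈ S i, z = boolPair (enc i) (padTo (witnessPoly.eval (enc i).length) (walkCode ω))}

variable {enc S}

/-- **Decomposition of a witness relation of padded walk codes** into the six `P` languages,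
given a canonicaliser `can = enc ∘ dec` of instance codes with `dec ∘ enc = id`, short walks, and
a verifier `V` deciding `decWalk (snd z) ∈ S (dec (fst z))`. [cite: AroraBarak2009, Def. 17.2 and §1.3] -/
theorem padRel_eq (dec : List Bool → ι) (hdec : ∀ i, dec (enc i) = i) {can : List Bool → List Bool}
    (hcan : ∀ x, can x = enc (dec x))
    (hlen : ∀ i, ∀ ω ∈ S i, (walkCode ω).length < witnessPoly.eval (enc i).length)
    {V : List Bool → List Bool} (hV : ∀ z, V z = [true] ↔ decWalk (sndF z) ∈ S (dec (fstF z))) :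
    padRel enc S = langA ⊓ langB can ⊓ langC ⊓ langD ⊓ langE ⊓ langV V := by
  ext z
  simp only [Language.mem_inf, mem_langA, mem_langB, mem_langC, mem_langD, mem_langE, mem_langV, hV]
  change (∃ i, ∃ ω ∈ S i, z = _) ↔ _
  constructor
  · rintro ⟨i, ω, hω, rfl⟩
    have hw : canonWalkF (boolPair (enc i) (padTo (witnessPoly.eval (enc i).length) (walkCode ω))) = walkCode ω := by
      simp only [canonWalkF, Function.comp_apply, sndF_boolPair, padTo, canonWalk_walkCode_append]
    have hr : restWalkF (boolPair (enc i) (padTo (witnessPoly.eval (enc i).length) (walkCode ω))) =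
        true :: List.replicate (witnessPoly.eval (enc i).length - (walkCode ω).length - 1) false := by
      simp only [restWalkF, Function.comp_apply, sndF_boolPair, padTo, nthRest_walkCode_append]
    refine ⟨⟨⟨⟨⟨rePair_boolPair _ _, ?_⟩, ?_⟩, ?_⟩, ?_⟩, ?_⟩
    · rw [fstF_boolPair, hcan, hdec]
    · rw [sndF_boolPair, fstF_boolPair, length_padTo (hlen i ω hω)]
    · rw [hw, hr, sndF_boolPair, padTo]
    · rw [hr]
      exact ⟨rfl, by simp [List.mem_replicate]⟩
    · rw [sndF_boolPair, fstF_boolPair, padTo, decWalk_walkCode_append, hdec]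
      exact hω
  · rintro ⟨⟨⟨⟨⟨hA', hB'⟩, hC'⟩, hD'⟩, ⟨hhead, htail⟩⟩, hF'⟩
    have hz : z = boolPair (fstF z) (sndF z) := hA'.symm
    have hxi : fstF z = enc (dec (fstF z)) := by rw [← hcan]; exact hB'.symm
    have hwy : canonWalkF z = walkCode (decWalk (sndF z)) := canonWalk_eq (sndF z)
    have htl : (restWalkF z).tail = List.replicate (restWalkF z).tail.length false :=
      List.eq_replicate_iff.2 ⟨rfl, fun b hb => by
        cases b
        · rfl
        · exact absurd hb htail⟩
    have hr : restWalkF z = true :: List.replicate (restWalkF z).tail.length false := by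
      rw [← htl]; exact List.eq_cons_of_mem_head? hhead
    have hy' : sndF z = walkCode (decWalk (sndF z)) ++ true :: List.replicate (restWalkF z).tail.length false := by
      conv_lhs => rw [hD', hwy, hr]
    have hm : (walkCode (decWalk (sndF z))).length + 1 + (restWalkF z).tail.length =
        witnessPoly.eval (enc (dec (fstF z))).length := by
      rw [← hxi, ← hC']
      conv_rhs => rw [hy']
      simp only [List.length_append, List.length_cons, List.length_replicate]
      omega
    have hk : (restWalkF z).tail.length = witnessPoly.eval (enc (dec (fstF z))).length -
        (walkCode (decWalk (sndF z))).length - 1 := by omega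
    have h2 : sndF z = walkCode (decWalk (sndF z)) ++ true :: List.replicate (witnessPoly.eval
        (enc (dec (fstF z))).length - (walkCode (decWalk (sndF z))).length - 1) false := by
      rw [← hk]; exact hy'
    refine ⟨dec (fstF z), decWalk (sndF z), hF', ?_⟩
    conv_lhs => rw [hz]
    rw [padTo, ← h2, ← hxi]

/-- **A witness relation of padded walk codes is in `P`** under the hypotheses of `padRel_eq`,
for `can ∈ FP` and a one-bit `V ∈ FP`. [cite: AroraBarak2009, Def. 17.2 and §1.3] -/
theorem padRel_mem_P (dec : List Bool → ι) (hdec : ∀ i, dec (enc i) = i) {can : List Bool → List Bool}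
    (hcan : ∀ x, can x = enc (dec x)) (hcanFP : can ∈ FP)
    (hlen : ∀ i, ∀ ω ∈ S i, (walkCode ω).length < witnessPoly.eval (enc i).length)
    {V : List Bool → List Bool} (hV1 : OneBit V) (hVFP : V ∈ FP)
    (hV : ∀ z, V z = [true] ↔ decWalk (sndF z) ∈ S (dec (fstF z))) : padRel enc S ∈ P := by
  rw [padRel_eq dec hdec hcan hlen hV]
  exact inter_mem_P (inter_mem_P (inter_mem_P (inter_mem_P (inter_mem_P langA_mem_P (langB_mem_P hcanFP))
    langC_mem_P) langD_mem_P) langE_mem_P) (langV_mem_P hV1 hVFP)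

end Relation

/-! ### The two verifiers and the discharge of the membership facts -/

/-- `canon₁` re-encodes the decoded instance. [folklore] -/
theorem canon₁_eq (x : List Bool) : canon₁ x = encodingFixedLengthInstance.encode (decInstance₁ x) := by
  unfold canon₁; rw [decode_instance₁]

/-- `decInstance₁` inverts the instance code. [folklore] -/
theorem decInstance₁_encode (i : EdgeList × GridPoint × ℕ) :
    decInstance₁ (encodingFixedLengthInstance.encode i) = i := by
  have h := decode_instance₁ (encodingFixedLengthInstance.encode i)
  rw [encodingFixedLengthInstance.decode_encode] at h
  exact (Option.some.inj h).symm

/-- The version-(4) instance read off any string. [folklore] -/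
def decInstance₄ (w : List Bool) : EdgeList × GridPoint := (decEdgeList (boolUnpair w).1, decPoint (boolUnpair w).2)

/-- The version-(4) decoder is total with value `decInstance₄`. [folklore] -/
theorem decode_instance₄ (w : List Bool) : encodingAnyLengthInstance.decode w = some (decInstance₄ w) :=
  (canonPairFn_eq _ _ decEdgeList decPoint decode_edgeList decode_point canonEdgeListFn_eq canonPointFn_eq w).1

/-- `canon₄` re-encodes the decoded instance. [folklore] -/
theorem canon₄_eq (x : List Bool) : canon₄ x = encodingAnyLengthInstance.encode (decInstance₄ x) := by
  unfold canon₄; rw [decode_instance₄]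

/-- `decInstance₄` inverts the instance code. [folklore] -/
theorem decInstance₄_encode (i : EdgeList × GridPoint) : decInstance₄ (encodingAnyLengthInstance.encode i) = i := by
  have h := decode_instance₄ (encodingAnyLengthInstance.encode i)
  rw [encodingAnyLengthInstance.decode_encode] at h
  exact (Option.some.inj h).symm

/-- The canonical argument of `sawChk` computed from a version-(1) pair `⟨x, y⟩`:
`⟨code E, ⟨code t, walkCode ω⟩⟩` for `(E, t, n) = decInstance₁ x`, `ω = decWalk y`. [folklore] -/
noncomputable def argF₁ : List Bool → List Bool :=
  fanoutFn (canonEdgeListFn ∘ fstF ∘ fstF)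
    (fanoutFn (canonPointFn ∘ fstF ∘ sndF ∘ fstF) (canonListFn canonPointFn ∘ sndF))

/-- `argF₁ ∈ FP`. [folklore] -/
theorem argF₁_mem_FP : argF₁ ∈ FP :=
  fanoutFn_mem_FP (comp_mem_FP canonEdgeListFn_mem_FP (comp_mem_FP fstF_mem_FP fstF_mem_FP))
    (fanoutFn_mem_FP (comp_mem_FP canonPointFn_mem_FP (comp_mem_FP fstF_mem_FP (comp_mem_FP sndF_mem_FP fstF_mem_FP)))
      (comp_mem_FP (canonListFn_mem_FP canonPointFn_mem_FP length_canonPointFn_le) sndF_mem_FP))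

/-- Value of `argF₁`. [folklore] -/
theorem argF₁_apply (z : List Bool) :
    argF₁ z = sawArg (decInstance₁ (fstF z)).1 (decInstance₁ (fstF z)).2.1 (decWalk (sndF z)) := by
  simp only [argF₁, fanoutFn_apply, Function.comp_apply, canonEdgeListFn_eq, canonPointFn_eq, canonWalk_eq,
    sawArg, decInstance₁, fstF, sndF]

/-- The length test of version (1): `|ω| = n + 1` on `⟨x, y⟩`. [folklore] -/
noncomputable def lenChk₁ : List Bool → List Bool :=
  eqPairFn ∘ fanoutFn (lenBinF ∘ fstF ∘ canonListFn canonPointFn ∘ sndF)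
    (addFn ∘ fanoutFn (canonF ∘ sndF ∘ sndF ∘ fstF) fun _ => [true])

/-- `lenChk₁ ∈ FP`. [folklore] -/
theorem lenChk₁_mem_FP : lenChk₁ ∈ FP :=
  comp_mem_FP eqPairFn_mem_FP (fanoutFn_mem_FP
    (comp_mem_FP lenBinF_mem_FP (comp_mem_FP fstF_mem_FP (comp_mem_FP
      (canonListFn_mem_FP canonPointFn_mem_FP length_canonPointFn_le) sndF_mem_FP)))
    (comp_mem_FP addFn_mem_FP (fanoutFn_mem_FP
      (comp_mem_FP canonF_mem_FP (comp_mem_FP sndF_mem_FP (comp_mem_FP sndF_mem_FP fstF_mem_FP))) (const_mem_FP _))))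

/-- `lenChk₁` is one-bit. [folklore] -/
theorem oneBit_lenChk₁ : OneBit lenChk₁ := oneBit_eqPairFn.comp _

/-- Truth of `lenChk₁`. [folklore] -/
theorem lenChk₁_eq_true (z : List Bool) :
    lenChk₁ z = [true] ↔ (decWalk (sndF z)).length = (decInstance₁ (fstF z)).2.2 + 1 := by
  have h1 : bitsToNat [true] = 1 := by simp [bitsToNat]
  simp only [lenChk₁, Function.comp_apply, fanoutFn_apply, eqPairFn_boolPair_eq_true, lenBinF_apply,
    canonWalk_eq, walkCode_eq, fstF_boolPair, Literature.Computability.MetaComplexity.length_unaryEncodeNat, addFn_boolPair, bitsToNat_canonF, h1,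
    encodeNat_inj]
  rfl

/-- **The verifier of version (1)**: `sawChk` on the canonicalised components, and the length
test. [cite: LiskiewiczOgiharaToda2003, Theorem 7 (version (1), membership in #P)] -/
noncomputable def verif₁ : List Bool → List Bool := andFn (sawChk ∘ argF₁) lenChk₁

/-- `verif₁ ∈ FP`. [folklore] -/
theorem verif₁_mem_FP : verif₁ ∈ FP :=
  andFn_mem_FP (comp_mem_FP sawChk_mem_FP argF₁_mem_FP) lenChk₁_mem_FP

/-- `verif₁` is one-bit. [folklore] -/
theorem oneBit_verif₁ : OneBit verif₁ := oneBit_andFn (oneBit_sawChk.comp _) oneBit_lenChk₁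

/-- **Truth of the verifier of version (1)**: it accepts `z` iff the walk read off `snd z` is
counted by version (1) at the instance read off `fst z`. [cite: LiskiewiczOgiharaToda2003, Theorem 7 (version (1))] -/
theorem verif₁_eq_true (z : List Bool) :
    verif₁ z = [true] ↔ decWalk (sndF z) ∈ walks₁ (decInstance₁ (fstF z)) := by
  rw [verif₁, andFn_eq_true_iff (oneBit_sawChk.comp _) oneBit_lenChk₁, Function.comp_apply, argF₁_apply,
    sawChk_sawArg_eq_true, lenChk₁_eq_true]
  simp only [walks₁, Set.mem_setOf_eq, and_assoc]

/-- `SAWRel₁` has the shape `padRel`. [folklore] -/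
theorem SAWRel₁_eq_padRel : SAWRel₁ = padRel encodingFixedLengthInstance.encode walks₁ := rfl

/-- **`SAWRel₁ ∈ P`** (the verifier hypothesis of `LOT2003_thm7_fixedLength_mem_of`).
[cite: LiskiewiczOgiharaToda2003, Theorem 7 (version (1), membership in #P)] [cite: AroraBarak2009, Def. 17.2] -/
theorem SAWRel₁_mem_P : SAWRel₁ ∈ P := by
  rw [SAWRel₁_eq_padRel]
  exact padRel_mem_P decInstance₁ decInstance₁_encode canon₁_eq canon₁_mem_FP
    length_walkCode_lt_of_mem_walks₁ oneBit_verif₁ verif₁_mem_FP verif₁_eq_true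

/-- The canonical argument of `sawChk` computed from a version-(4) pair `⟨x, y⟩`. [folklore] -/
noncomputable def argF₄ : List Bool → List Bool :=
  fanoutFn (canonEdgeListFn ∘ fstF ∘ fstF) (fanoutFn (canonPointFn ∘ sndF ∘ fstF) (canonListFn canonPointFn ∘ sndF))

/-- `argF₄ ∈ FP`. [folklore] -/
theorem argF₄_mem_FP : argF₄ ∈ FP :=
  fanoutFn_mem_FP (comp_mem_FP canonEdgeListFn_mem_FP (comp_mem_FP fstF_mem_FP fstF_mem_FP))
    (fanoutFn_mem_FP (comp_mem_FP canonPointFn_mem_FP (comp_mem_FP sndF_mem_FP fstF_mem_FP))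
      (comp_mem_FP (canonListFn_mem_FP canonPointFn_mem_FP length_canonPointFn_le) sndF_mem_FP))

/-- Value of `argF₄`. [folklore] -/
theorem argF₄_apply (z : List Bool) :
    argF₄ z = sawArg (decInstance₄ (fstF z)).1 (decInstance₄ (fstF z)).2 (decWalk (sndF z)) := by
  simp only [argF₄, fanoutFn_apply, Function.comp_apply, canonEdgeListFn_eq, canonPointFn_eq, canonWalk_eq,
    sawArg, decInstance₄, fstF, sndF]

/-- **The verifier of version (4)**: `sawChk` on the canonicalised components.
[cite: LiskiewiczOgiharaToda2003, Theorem 7 (version (4), membership in #P)] -/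
noncomputable def verif₄ : List Bool → List Bool := sawChk ∘ argF₄

/-- `verif₄ ∈ FP`. [folklore] -/
theorem verif₄_mem_FP : verif₄ ∈ FP := comp_mem_FP sawChk_mem_FP argF₄_mem_FP

/-- `verif₄` is one-bit. [folklore] -/
theorem oneBit_verif₄ : OneBit verif₄ := oneBit_sawChk.comp _

/-- **Truth of the verifier of version (4).** [cite: LiskiewiczOgiharaToda2003, Theorem 7 (version (4))] -/
theorem verif₄_eq_true (z : List Bool) :
    verif₄ z = [true] ↔ decWalk (sndF z) ∈ walks₄ (decInstance₄ (fstF z)) := by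
  rw [verif₄, Function.comp_apply, argF₄_apply, sawChk_sawArg_eq_true]
  simp only [walks₄, Set.mem_setOf_eq]

/-- `SAWRel₄` has the shape `padRel`. [folklore] -/
theorem SAWRel₄_eq_padRel : SAWRel₄ = padRel encodingAnyLengthInstance.encode walks₄ := rfl

/-- **`SAWRel₄ ∈ P`** (the verifier hypothesis of `SAWCOUNT₄_mem_SharpP_of`).
[cite: LiskiewiczOgiharaToda2003, Theorem 7 (version (4), membership in #P)] [cite: AroraBarak2009, Def. 17.2] -/
theorem SAWRel₄_mem_P : SAWRel₄ ∈ P := by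
  rw [SAWRel₄_eq_padRel]
  exact padRel_mem_P decInstance₄ decInstance₄_encode canon₄_eq canon₄_mem_FP
    length_walkCode_lt_of_mem_walks₄ oneBit_verif₄ verif₄_mem_FP verif₄_eq_true

/-- **Discharge of `LOT2003_thm7_fixedLength_mem`: `SAWCOUNT₁ ∈ #P`** — the membership half of
Theorem 7 (1) of Liśkiewicz–Ogihara–Toda 2003 over the tree's `#P` (Arora–Barak Def. 17.2:
a polynomial-time relation counting padded walk codes exactly, `GridSAWCountingMembership.lean`,
fed with the verifier `SAWRel₁_mem_P` and the transcoder `canon₁_mem_FP`).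
[cite: LiskiewiczOgiharaToda2003, Theorem 7 (version (1), membership in #P)] -/
theorem LOT2003_thm7_fixedLength_mem_holds : LOT2003_thm7_fixedLength_mem :=
  LOT2003_thm7_fixedLength_mem_of SAWRel₁_mem_P canon₁_mem_FP

/-- **Discharge of `LOT2003_thm7_anyLength_mem`: `SAWCOUNT₄ ∈ #P`** — the membership half of
Theorem 7 (4). [cite: LiskiewiczOgiharaToda2003, Theorem 7 (version (4), membership in #P)] -/
theorem LOT2003_thm7_anyLength_mem_holds : LOT2003_thm7_anyLength_mem :=
  SAWCOUNT₄_mem_SharpP_of SAWRel₄_mem_P canon₄_mem_FP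

end Literature.Barriers.CriticalPhenomena.GridSAW
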